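import Summits.RiemannHypothesis.RiemannHypothesis.Theorems.TiltedLandingLaw421R3ClusterQM
import Summits.RiemannHypothesis.RiemannHypothesis.Theorems.TiltedLandingLaw421R3AntiEscapeIso

/-!
# W-08 · C1 (rh-idea-5 g28) — `ClusterQMP`: DISC-WISE depth for the upper model door (C6 ADD-146 ask-back) and the CORNER-WINDOW door

Purely additive DELTA to `…R3ClusterQM` (= C1 g27 image `ClusterQM-v2` 49d1f8d2: §L lateral budget, §U `exists_deriv_zero_of_model_zero`,
`succ_of_upper_model_zero`).  SUPPORT only (`--supports stmt-RiemannHypothesis-24774 --as helper`): proves no stub, no crux, no `sorry`; every theorem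
is a DOOR LEMMA for instances of the SUCC residual of record `RhW08.SuccSplit.AntiEscapeCore` (#1053) — NO LAW is typed ((CA387)(2)).

§P DISC-WISE DEPTH (C6 rh-idea-4 g28 ADD-146: the cover-disc depth `hdepth` of `succ_of_upper_model_zero` certifies 363 / 428 FF-only in-scope
levels; the disc-wise form certifies 428 / 428 — the 65 extra levels are lateral states hugging the `ψ_{j+1} = 0` curve, where the real-centred cover
disc `D(Re c, ρ + |Im c|)` overshoots but the small disc `D̄(c, ρ)` itself lies in the level-`(j+1)` band region):
* ★ `succ_of_nonreal_zero_inBand` — a NON-REAL zero `z` of `f^{(j+1)}` satisfying the level-`(j+1)` band inequality AT `z` is (after reflection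
  to the upper half-plane) a level-`(j+1)` band state; `Im ≤ Hs` comes from STRIP HEREDITY (`RhW08.Column.abs_im_le_of_level`), never from the disc.
* ★★★ `succ_of_upper_model_zero_pt` — the §U door with `hdepth` replaced by
  `hdisc : ∀ z, ‖z − c‖ < ρ → |Im z| ≤ Hs → (|Re z − x₀| − R/2)₊² + (j+1)·Im z² ≤ (j+1)·Hs²`
  (the band inequality on the part of the OPEN disc inside the strip; the strip guard `|Im z| ≤ Hs` is what lets the col branch of v2 — which
  carries no height clause, C6's FLAG — be an instance: ★ `discDepth_of_coverDepth` proves v2's `hdepth` ⇒ `hdisc`, and the `example` after it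
  re-derives `succ_of_upper_model_zero` from `_pt`, so the new door SUBSUMES the old one by a kernel-checked implication).
§T TILT CANCELLATION (desk (Q9″) replay socket): ★ `deriv_expTilt`, ★ `dom_iff_expTilt` — for `G = e^{γ·}·P`, `h = e^{γ·}·P₂` the circle inequality
`‖G′ − M·h‖ < ‖M·h‖` ⟺ `‖P′ + γP − M·P₂‖ < ‖M·P₂‖` (no exponential left); ★★ `succ_of_upper_model_zero_expTilt` — the door for poly×exp frames with
ONLY polynomial-type hypotheses (`P₂ ≠ 0` on the closed disc, the exponential-free circle inequality, a zero of `M` inside, disc-wise depth).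
§W THE CORNER-WINDOW DOOR (new; tree-only ingredients): ★ `upperZero_or_nlEvent_of_window` — the `hband`-FREE half of tree
`RhW08.QuadW.band_successor_or_nlEvent_of_window` (Kim 1996 Thm 1 local dichotomy on a Jensen `Window` of `f^{(j)}` with a couple inside:
¬ local A ⇒ an UPPER zero of `f^{(j+1)}` IN the open window; ¬ local B ⇒ an NL event on the base); ★★★ `succ_or_readyR2_of_window_corners` — legal
frame, a band state at level `j`, ANY Jensen window of `f^{(j)}` (it need not contain `v`, and its members need NOT be in `BAND_j`: MIXED windows
allowed) with a couple inside whose two TOP CORNERS satisfy the level-`(j+1)` band inequality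
`(max(|α − x₀|, |β − x₀|) − R/2)₊² + (j+1)·min(h, Hs)² ≤ (j+1)·Hs²` ⇒ a level-`(j+1)` band state exists OR `ReadyR2` at level `j` (the NL event is in
the LAW's range because the corner inequality forces `max|· − x₀| < (j+2)R/2`, via `range_of_lateral`; the `min(h, Hs)` is strip heredity: a zero of
`f^{(j+1)}` in the box has `Im ≤ Hs` anyway); ★ `antiEscape_instance_of_window_corners` — the `AntiEscapeCore`-shaped instance; ★ `corner_of_columnBase`
— a window whose base lies in the column satisfies the corner inequality for EVERY `h`, so this door GENERALISES tree
`RhW08.Column.column_successor_or_nlEvent_of_window` (…R3ColumnImmunity, C1 g26: base inside the column) from the column to LATERAL boxes with a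
height cap.  Incomparable with `RhW08.SuccB.AllInBandInRangeWindow` (that one constrains the MEMBERS at level `j`, this one the BOX at level `j+1`;
`region_{j+1} ⊋ band_j`, so at small `j` the corner door fires on windows that are not all-in-band).  Census of its reach on the 1 398 in-scope
levels is asked of C6 as (Q12).
Nothing here bears on the truth of RH; models ≠ ξ; RH is NOT proved; `TiltedLandingLaw421` (24774) stays OPEN.
-/

namespace RhW08.ClusterQM

open Complex Set
open scoped ComplexConjugate
open Literature.Analysis.Complex
open Summit.RiemannHypothesis.RiemannHypothesis.Theorems.Splittings.JensenWindow
open RhIdea6.G17.W07C7 RhIdea6.G17.W07C7.Rev6 RhIdea6.G18.W07C8.Law421BirthS RhIdea6.G19.W07C11.Seam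
open RhIdea6.G20.W07C12.Frac RhIdea6.G20.W07C12.StColP RhW07.C12.FieldSplit RhIdea6.G21.W07C13.TentMax
open RhW07.C14.TwoSided RhW07.C14.Classes RhW07.C14.Lineage RhW07.C14.Booking
open RhW07.C13.Heredity RhIdea6.G22.W07C15pre.Injection RhW07.E3.Cell RhW07.E3.Lit
open RhW08.Round1 RhW08.StSwap RhW08.Round2 RhW08.QuadW RhW08.SealSwapQ RhW08.SuccB RhW08.SuccSplit RhW08.SuccTheft
open RhW08.Column RhW08.Hurwitz
open RhW08.ClusterQ

/-! ## §P DISC-WISE depth for the upper model door (C6 ADD-146 ask-back) -/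

/-- ★ POINTWISE BAND MEMBERSHIP ⇒ SUCCESSOR: legal frame, a band state `v` at level `j` (so `f^{(j+1)} ≢ 0`), a NON-REAL zero `z` of `f^{(j+1)}`
satisfying the level-`(j+1)` band inequality AT `z` ⇒ a level-`(j+1)` band state (reflect `z` to the upper half-plane; `Im ≤ Hs` by strip heredity). -/
theorem succ_of_nonreal_zero_inBand {η : ℝ} {f : ℂ → ℂ} {x₀ s hmax R Hs : ℝ} {B j : ℕ} {v z : ℂ}
    (hE : EngineHyps5 2 η f x₀ s hmax R Hs B) (hv : StTrkDQ η f x₀ s hmax R Hs B j v)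
    (hz : iteratedDeriv (j + 1) f z = 0) (hzim : z.im ≠ 0)
    (hband : (max (|z.re - x₀| - R / 2) 0) ^ 2 + ((j : ℝ) + 1) * z.im ^ 2 ≤ ((j : ℝ) + 1) * Hs ^ 2) :
    ∃ u : ℂ, StTrkDQ η f x₀ s hmax R Hs B (j + 1) u := by
  obtain ⟨u, hu, hup, hure, huim⟩ := exists_upper_zero_of_nonreal hE.1 hE.2.1 (j + 1) hz hzim
  have hnz : iteratedDeriv (j + 1) f ≠ 0 := iteratedDeriv_succ_ne_zero_of_zero hE.1 j hv.1 hv.2.1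
  refine ⟨u, stTrkDQ_of_lateral hE hnz hu hup ?_⟩
  have hcast : ((j + 1 : ℕ) : ℝ) = (j : ℝ) + 1 := by push_cast; ring
  have him2 : u.im ^ 2 = z.im ^ 2 := by rw [← sq_abs u.im, huim, sq_abs]
  rw [hcast, hure, him2]
  exact hband

/-- ★★★ THE UPPER MODEL DOOR, DISC-WISE DEPTH (C6 ADD-146: certifies 428 / 428 FF-only in-scope levels).  Legal frame, band state `v` at level `j`;
a disc `‖z − c‖ ≤ ρ` OFF THE REAL AXIS (`ρ ≤ |Im c|`) on which an entire `h` is zero-free, an entire model `M ≢ 0` dominating `f^{(j+1)}` against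
`M·h` on the circle (`‖f^{(j+1)} − M·h‖ < ‖M·h‖`) and vanishing somewhere inside, and the level-`(j+1)` band inequality at every point of the open
disc inside the strip `|Im z| ≤ Hs` ⇒ a level-`(j+1)` band state.  No real pigeonhole, no teeth, no cover disc. -/
theorem succ_of_upper_model_zero_pt {η : ℝ} {f : ℂ → ℂ} {x₀ s hmax R Hs : ℝ} {B j : ℕ} {v : ℂ} (hE : EngineHyps5 2 η f x₀ s hmax R Hs B)
    (hv : StTrkDQ η f x₀ s hmax R Hs B j v) {c : ℂ} {ρ : ℝ} (hρ : 0 < ρ) (hoff : ρ ≤ |c.im|) {h M : ℂ → ℂ}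
    (hh : Differentiable ℂ h) (hM : Differentiable ℂ M) (hMne : M ≠ 0) (hh0 : ∀ z : ℂ, ‖z - c‖ ≤ ρ → h z ≠ 0)
    (hdom : ∀ z : ℂ, ‖z - c‖ = ρ → ‖iteratedDeriv (j + 1) f z - M z * h z‖ < ‖M z * h z‖)
    (hMz : ∃ z₀ : ℂ, ‖z₀ - c‖ < ρ ∧ M z₀ = 0)
    (hdisc : ∀ z : ℂ, ‖z - c‖ < ρ → |z.im| ≤ Hs →
      (max (|z.re - x₀| - R / 2) 0) ^ 2 + ((j : ℝ) + 1) * z.im ^ 2 ≤ ((j : ℝ) + 1) * Hs ^ 2) :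
    ∃ u : ℂ, StTrkDQ η f x₀ s hmax R Hs B (j + 1) u := by
  have hG : Differentiable ℂ (iteratedDeriv j f) := differentiable_iteratedDeriv_of_entire hE.1 j
  have hdom' : ∀ z : ℂ, ‖z - c‖ = ρ → ‖deriv (iteratedDeriv j f) z - M z * h z‖ < ‖M z * h z‖ := by
    intro z hz; rw [← iteratedDeriv_succ]; exact hdom z hz
  obtain ⟨u, huc, hu⟩ := exists_deriv_zero_of_model_zero hρ hG hh hM hMne hh0 hdom' hMz
  rw [← iteratedDeriv_succ] at hu
  have huim : u.im ≠ 0 := by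
    intro h0
    have h1 : |(u - c).im| ≤ ‖u - c‖ := Complex.abs_im_le_norm _
    have h2 : (u - c).im = u.im - c.im := by simp
    rw [h2, h0, zero_sub, abs_neg] at h1
    linarith
  have hnz : iteratedDeriv (j + 1) f ≠ 0 := iteratedDeriv_succ_ne_zero_of_zero hE.1 j hv.1 hv.2.1
  have huHs : |u.im| ≤ Hs := abs_im_le_of_level hE hnz hu
  exact succ_of_nonreal_zero_inBand hE hv hu huim (hdisc u huc huHs)

/-- ★ v2's COVER-DISC depth (column-deep OR lateral budget for `D(Re c, ρ + |Im c|)`) ⇒ the DISC-WISE depth of `succ_of_upper_model_zero_pt`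
(answers C6's FLAG: the col branch carries no height clause because the height is the strip guard `|Im z| ≤ Hs`). -/
theorem discDepth_of_coverDepth {x₀ R Hs : ℝ} {j : ℕ} {c : ℂ} {ρ : ℝ}
    (hdepth : |c.re - x₀| + (ρ + |c.im|) ≤ R / 2 ∨
      (max (|c.re - x₀| + (ρ + |c.im|) - R / 2) 0) ^ 2 + ((j : ℝ) + 1) * (ρ + |c.im|) ^ 2 ≤ ((j : ℝ) + 1) * Hs ^ 2) :
    ∀ z : ℂ, ‖z - c‖ < ρ → |z.im| ≤ Hs →
      (max (|z.re - x₀| - R / 2) 0) ^ 2 + ((j : ℝ) + 1) * z.im ^ 2 ≤ ((j : ℝ) + 1) * Hs ^ 2 := by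
  intro z hz hzHs
  have hre : |z.re - c.re| ≤ ρ := by
    have h1 : |(z - c).re| ≤ ‖z - c‖ := Complex.abs_re_le_norm _
    have h2 : (z - c).re = z.re - c.re := by simp
    rw [h2] at h1; linarith
  have him : |z.im - c.im| ≤ ρ := by
    have h1 : |(z - c).im| ≤ ‖z - c‖ := Complex.abs_im_le_norm _
    have h2 : (z - c).im = z.im - c.im := by simp
    rw [h2] at h1; linarith
  have hzre : |z.re - x₀| ≤ |c.re - x₀| + ρ := by
    have h3 : |z.re - x₀| ≤ |z.re - c.re| + |c.re - x₀| := by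
      have := abs_add_le (z.re - c.re) (c.re - x₀); simp only [sub_add_sub_cancel] at this; exact this
    linarith
  have hzim : |z.im| ≤ ρ + |c.im| := by
    have h3 : |z.im| ≤ |z.im - c.im| + |c.im| := by
      have := abs_add_le (z.im - c.im) c.im; simp only [sub_add_cancel] at this; exact this
    linarith
  have hj : (0 : ℝ) ≤ (j : ℝ) + 1 := by positivity
  have hzim2 : z.im ^ 2 ≤ Hs ^ 2 := by
    rw [← sq_abs z.im]; exact pow_le_pow_left₀ (abs_nonneg _) hzHs 2
  rcases hdepth with hcol | hlat
  · have hm : max (|z.re - x₀| - R / 2) 0 = 0 := by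
      apply max_eq_right; linarith [abs_nonneg c.im]
    rw [hm]
    nlinarith [mul_le_mul_of_nonneg_left hzim2 hj]
  · have hover : |z.re - x₀| - R / 2 ≤ |c.re - x₀| + (ρ + |c.im|) - R / 2 := by linarith [abs_nonneg c.im]
    have hmax : max (|z.re - x₀| - R / 2) 0 ≤ max (|c.re - x₀| + (ρ + |c.im|) - R / 2) 0 := max_le_max hover le_rfl
    have hmax0 : 0 ≤ max (|z.re - x₀| - R / 2) 0 := le_max_right _ _
    have hsq : (max (|z.re - x₀| - R / 2) 0) ^ 2 ≤ (max (|c.re - x₀| + (ρ + |c.im|) - R / 2) 0) ^ 2 :=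
      pow_le_pow_left₀ hmax0 hmax 2
    have hzim3 : z.im ^ 2 ≤ (ρ + |c.im|) ^ 2 := by
      rw [← sq_abs z.im]; exact pow_le_pow_left₀ (abs_nonneg _) hzim 2
    nlinarith [mul_le_mul_of_nonneg_left hzim3 hj]

/-- SUBSUMPTION, kernel-certified: v2's `succ_of_upper_model_zero` is the instance `hdisc := discDepth_of_coverDepth hdepth` of `_pt`. -/
example {η : ℝ} {f : ℂ → ℂ} {x₀ s hmax R Hs : ℝ} {B j : ℕ} {v : ℂ} (hE : EngineHyps5 2 η f x₀ s hmax R Hs B)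
    (hv : StTrkDQ η f x₀ s hmax R Hs B j v) {c : ℂ} {ρ : ℝ} (hρ : 0 < ρ) (hoff : ρ ≤ |c.im|) {h M : ℂ → ℂ}
    (hh : Differentiable ℂ h) (hM : Differentiable ℂ M) (hMne : M ≠ 0) (hh0 : ∀ z : ℂ, ‖z - c‖ ≤ ρ → h z ≠ 0)
    (hdom : ∀ z : ℂ, ‖z - c‖ = ρ → ‖iteratedDeriv (j + 1) f z - M z * h z‖ < ‖M z * h z‖)
    (hMz : ∃ z₀ : ℂ, ‖z₀ - c‖ < ρ ∧ M z₀ = 0)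
    (hdepth : |c.re - x₀| + (ρ + |c.im|) ≤ R / 2 ∨
      (max (|c.re - x₀| + (ρ + |c.im|) - R / 2) 0) ^ 2 + ((j : ℝ) + 1) * (ρ + |c.im|) ^ 2 ≤ ((j : ℝ) + 1) * Hs ^ 2) :
    ∃ u : ℂ, StTrkDQ η f x₀ s hmax R Hs B (j + 1) u :=
  succ_of_upper_model_zero_pt hE hv hρ hoff hh hM hMne hh0 hdom hMz (discDepth_of_coverDepth hdepth)

/-! ## §T TILT CANCELLATION — the poly×exp replay socket (desk (Q9″) / C6's 428 certificates are polynomial inequalities) -/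

/-- `d/dz (e^{γz}·P) = e^{γz}·(P′ + γP)`. -/
theorem deriv_expTilt {P : ℂ → ℂ} {γ : ℂ} (hP : Differentiable ℂ P) (z : ℂ) :
    deriv (fun w => Complex.exp (γ * w) * P w) z = Complex.exp (γ * z) * (deriv P z + γ * P z) := by
  have h1 : HasDerivAt (fun w => Complex.exp (γ * w)) (Complex.exp (γ * z) * γ) z := by
    have hlin : HasDerivAt (fun w : ℂ => γ * w) γ z := by
      simpa using (hasDerivAt_id z).const_mul γ
    exact (Complex.hasDerivAt_exp (γ * z)).comp z hlin
  have h2 : HasDerivAt (fun w => Complex.exp (γ * w) * P w) (Complex.exp (γ * z) * γ * P z + Complex.exp (γ * z) * deriv P z) z :=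
    h1.mul (hP z).hasDerivAt
  rw [h2.deriv]; ring

/-- ★ TILT CANCELLATION: with `G = e^{γ·}·P` and `h = e^{γ·}·P₂`, the Rouché circle inequality `‖G′ − M·h‖ < ‖M·h‖` at `z` is EQUIVALENT to the
exponential-free inequality `‖P′ z + γ·P z − M z·P₂ z‖ < ‖M z·P₂ z‖` (`|e^{γz}| > 0` divides out).  For a poly×exp frame every hypothesis of the
upper model door is therefore an inequality between polynomials with explicit coefficients — the currency of C6's 428 certificates (ADD-146). -/
theorem dom_iff_expTilt {P P₂ M : ℂ → ℂ} {γ : ℂ} (hP : Differentiable ℂ P) (z : ℂ) :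
    ‖deriv (fun w => Complex.exp (γ * w) * P w) z - M z * (Complex.exp (γ * z) * P₂ z)‖ <
        ‖M z * (Complex.exp (γ * z) * P₂ z)‖ ↔
      ‖deriv P z + γ * P z - M z * P₂ z‖ < ‖M z * P₂ z‖ := by
  rw [deriv_expTilt hP z]
  have e1 : Complex.exp (γ * z) * (deriv P z + γ * P z) - M z * (Complex.exp (γ * z) * P₂ z)
      = Complex.exp (γ * z) * (deriv P z + γ * P z - M z * P₂ z) := by ring
  have e2 : M z * (Complex.exp (γ * z) * P₂ z) = Complex.exp (γ * z) * (M z * P₂ z) := by ring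
  rw [e1, e2, norm_mul, norm_mul]
  have hpos : 0 < ‖Complex.exp (γ * z)‖ := norm_pos_iff.mpr (Complex.exp_ne_zero _)
  exact mul_lt_mul_iff_of_pos_left hpos

/-- ★★ THE POLY×EXP REPLAY SOCKET of `succ_of_upper_model_zero_pt`: if `f^{(j)} = e^{γ·}·P` (a poly×exp frame at level `j`; `γ : ℂ`, `P` entire) and
`h := e^{γ·}·P₂` (`P₂` = the far factor, zero-free on the closed disc), then the door's analytic hypotheses are `P₂ ≠ 0` on the closed disc, the
exponential-free circle inequality `‖P′ + γP − M·P₂‖ < ‖M·P₂‖`, and a zero of the model `M` inside — plus the disc-wise depth. -/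
theorem succ_of_upper_model_zero_expTilt {η : ℝ} {f : ℂ → ℂ} {x₀ s hmax R Hs : ℝ} {B j : ℕ} {v : ℂ} (hE : EngineHyps5 2 η f x₀ s hmax R Hs B)
    (hv : StTrkDQ η f x₀ s hmax R Hs B j v) {γ : ℂ} {P P₂ M : ℂ → ℂ} (hG : iteratedDeriv j f = fun w => Complex.exp (γ * w) * P w)
    (hP : Differentiable ℂ P) (hP₂ : Differentiable ℂ P₂) (hM : Differentiable ℂ M) (hMne : M ≠ 0)
    {c : ℂ} {ρ : ℝ} (hρ : 0 < ρ) (hoff : ρ ≤ |c.im|)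
    (hP₂0 : ∀ z : ℂ, ‖z - c‖ ≤ ρ → P₂ z ≠ 0)
    (hdomP : ∀ z : ℂ, ‖z - c‖ = ρ → ‖deriv P z + γ * P z - M z * P₂ z‖ < ‖M z * P₂ z‖)
    (hMz : ∃ z₀ : ℂ, ‖z₀ - c‖ < ρ ∧ M z₀ = 0)
    (hdisc : ∀ z : ℂ, ‖z - c‖ < ρ → |z.im| ≤ Hs →
      (max (|z.re - x₀| - R / 2) 0) ^ 2 + ((j : ℝ) + 1) * z.im ^ 2 ≤ ((j : ℝ) + 1) * Hs ^ 2) :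
    ∃ u : ℂ, StTrkDQ η f x₀ s hmax R Hs B (j + 1) u := by
  have hh : Differentiable ℂ (fun w => Complex.exp (γ * w) * P₂ w) := by fun_prop
  refine succ_of_upper_model_zero_pt (h := fun w => Complex.exp (γ * w) * P₂ w) hE hv hρ hoff hh hM hMne
    (fun z hz => ?_) (fun z hz => ?_) hMz hdisc
  · exact mul_ne_zero (Complex.exp_ne_zero _) (hP₂0 z hz)
  · rw [iteratedDeriv_succ, hG]
    exact (dom_iff_expTilt hP z).mpr (hdomP z hz)

/-! ## §W The CORNER-WINDOW door (Jensen-window census without the all-in-band hypothesis) -/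

/-- ★ `hband`-FREE LOCAL DICHOTOMY (Kim 1996 Thm 1, count-free; the first half of tree `band_successor_or_nlEvent_of_window`): `f` real entire of
order `< 2`, a Jensen `Window` of `f^{(j)}` with a couple inside ⇒ EITHER an UPPER zero of `f^{(j+1)}` in the open window OR an NL event on the base. -/
theorem upperZero_or_nlEvent_of_window {f : ℂ → ℂ} (hf : RealEntireLt2 f) (j : ℕ)
    {α β h : ℝ} (hW : Window (iteratedDeriv j f) α β h)
    (hJ : ∃ u ∈ Ioo α β ×ℂ Ioo (-h) h, iteratedDeriv j f u = 0 ∧ u.im ≠ 0) :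
    (∃ w ∈ Ioo α β ×ℂ Ioo (-h) h, iteratedDeriv (j + 1) f w = 0 ∧ 0 < w.im) ∨ (∃ c ∈ Ioo α β, NLEventOf f j c) := by
  set G : ℂ → ℂ := iteratedDeriv j f with hGdef
  have hG : RealEntireLt2 G :=
    { diff := differentiable_iteratedDeriv_of_entire hf.diff j
      growth := by
        obtain ⟨ρ, C, hρ0, hρ, hgr⟩ := hf.growth
        obtain ⟨ρ', C', h1, h2, h3⟩ := exists_growth_iteratedDeriv hf.diff hρ0 hρ hgr j
        exact ⟨ρ', C', h1, h2, h3⟩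
      real := im_iteratedDeriv_ofReal hf.diff hf.real j }
  have e1 : deriv G = iteratedDeriv (j + 1) f := by rw [hGdef, ← iteratedDeriv_succ]
  by_cases hB : LocalB G α β
  swap
  · exact Or.inr (nlEventOf_of_not_localB hf j hB)
  by_cases hA : LocalA G α β h
  · exfalso
    obtain ⟨u, hu, hGu, huim⟩ := hJ
    exact huim (no_nonreal_zero_of_localA_localB hG hW hA hB u hu hGu)
  left
  unfold LocalA at hA
  push Not at hA
  obtain ⟨ρ, hρ, hdρ, hρim⟩ := hA
  have hdreal : ∀ x : ℝ, (deriv G x).im = 0 := im_deriv_ofReal hG.diff hG.real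
  obtain ⟨w, hw, hdw, hwpos⟩ : ∃ w ∈ Ioo α β ×ℂ Ioo (-h) h, deriv G w = 0 ∧ 0 < w.im := by
    rcases lt_or_gt_of_ne hρim with hneg | hpos
    · refine ⟨conj ρ, ?_, ?_, ?_⟩
      · rw [mem_reProdIm] at hρ ⊢
        obtain ⟨h1, h2, h3⟩ := hρ
        refine ⟨by simpa using h1, ?_, ?_⟩
        · simp only [Complex.conj_im]; linarith [h3]
        · simp only [Complex.conj_im]; linarith [h2]
      · rw [apply_conj_eq_conj (differentiable_deriv hG.diff) hdreal ρ, hdρ, map_zero]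
      · simpa using hneg
    · exact ⟨ρ, hρ, hdρ, hpos⟩
  exact ⟨w, hw, by rw [← e1]; exact hdw, hwpos⟩

/-- `|c − x₀| ≤ max(|α − x₀|, |β − x₀|)` for `c ∈ (α, β)` (convexity of `|· − x₀|`). -/
theorem abs_sub_le_max_of_mem_Ioo {c α β x₀ : ℝ} (hc : c ∈ Ioo α β) : |c - x₀| ≤ max |α - x₀| |β - x₀| := by
  rw [abs_le]
  constructor
  · have h1 : -|α - x₀| ≤ α - x₀ := neg_abs_le _
    have h2 : |α - x₀| ≤ max |α - x₀| |β - x₀| := le_max_left _ _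
    linarith [hc.1]
  · have h1 : β - x₀ ≤ |β - x₀| := le_abs_self _
    have h2 : |β - x₀| ≤ max |α - x₀| |β - x₀| := le_max_right _ _
    linarith [hc.2]

/-- ★★★ THE CORNER-WINDOW DOOR.  Legal frame, band state `v` at level `j`; ANY Jensen `Window (f^{(j)}) α β h` (it need not contain `v`; its members
need NOT be in `BAND_j`) with a couple inside, whose two TOP CORNERS `α + ih`, `β + ih` satisfy the level-`(j+1)` band inequality
`(max(|α − x₀|, |β − x₀|) − R/2)₊² + (j+1)·min(h, Hs)² ≤ (j+1)·Hs²` ⇒ a level-`(j+1)` band state exists, OR `ReadyR2` holds at level `j`.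
(Window census: an upper zero of `f^{(j+1)}` in the open box — band-deep because the box-within-the-strip is, by the corners, monotonicity and strip
heredity `Im ≤ Hs` — or an NL event on `(α, β)`, in range `|c − x₀| < (j+3)R/2` because the corner inequality gives `max|· − x₀| < (j+2)R/2` via
`range_of_lateral`.)  The column door `RhW08.Column.column_successor_or_nlEvent_of_window` is the case `max(|α − x₀|, |β − x₀|) ≤ R/2` (`corner_of_columnBase`). -/
theorem succ_or_readyR2_of_window_corners {η : ℝ} {f : ℂ → ℂ} {x₀ s hmax R Hs : ℝ} {B j : ℕ} {v : ℂ}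
    (hE : EngineHyps5 2 η f x₀ s hmax R Hs B) (hv : StTrkDQ η f x₀ s hmax R Hs B j v)
    {α β h : ℝ} (hW : Window (iteratedDeriv j f) α β h)
    (hJ : ∃ u ∈ Ioo α β ×ℂ Ioo (-h) h, iteratedDeriv j f u = 0 ∧ u.im ≠ 0)
    (hcorner : (max (max |α - x₀| |β - x₀| - R / 2) 0) ^ 2 + ((j : ℝ) + 1) * (min h Hs) ^ 2 ≤ ((j : ℝ) + 1) * Hs ^ 2) :
    (∃ u : ℂ, StTrkDQ η f x₀ s hmax R Hs B (j + 1) u) ∨ ReadyR2 η f x₀ s hmax R Hs B j v := by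
  have hf : RealEntireLt2 f := realEntireLt2_of_hyps hE
  set M : ℝ := max |α - x₀| |β - x₀| with hMdef
  have hM0 : 0 ≤ M := le_trans (abs_nonneg _) (le_max_left _ _)
  have hj : (0 : ℝ) ≤ (j : ℝ) + 1 := by positivity
  rcases upperZero_or_nlEvent_of_window hf j hW hJ with ⟨w, hw, hfw, hwpos⟩ | ⟨c, hc, hNL⟩
  · left
    have hw' := hw
    rw [mem_reProdIm] at hw'
    obtain ⟨hwre, hwim⟩ := hw'
    have hre : |w.re - x₀| ≤ M := abs_sub_le_max_of_mem_Ioo hwre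
    have hmax : max (|w.re - x₀| - R / 2) 0 ≤ max (M - R / 2) 0 := max_le_max (by linarith) le_rfl
    have hmax0 : 0 ≤ max (|w.re - x₀| - R / 2) 0 := le_max_right _ _
    have hsq : (max (|w.re - x₀| - R / 2) 0) ^ 2 ≤ (max (M - R / 2) 0) ^ 2 := pow_le_pow_left₀ hmax0 hmax 2
    have hnz : iteratedDeriv (j + 1) f ≠ 0 := iteratedDeriv_succ_ne_zero_of_zero hE.1 j hv.1 hv.2.1
    have hwHs : w.im ≤ Hs := by
      have := abs_im_le_of_level hE hnz hfw
      rwa [abs_of_pos hwpos] at this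
    have hwmin : w.im ≤ min h Hs := le_min hwim.2.le hwHs
    have him2 : w.im ^ 2 ≤ (min h Hs) ^ 2 := pow_le_pow_left₀ hwpos.le hwmin 2
    exact succ_of_nonreal_zero_inBand hE hv hfw hwpos.ne' (by nlinarith [mul_le_mul_of_nonneg_left him2 hj])
  · right
    have hlat : (max (|(x₀ + M) - x₀| + 0 - R / 2) 0) ^ 2 + ((j : ℝ) + 1) * (0 : ℝ) ^ 2 ≤ ((j : ℝ) + 1) * Hs ^ 2 := by
      have e : |(x₀ + M) - x₀| + 0 - R / 2 = M - R / 2 := by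
        rw [show (x₀ + M) - x₀ = M by ring, abs_of_nonneg hM0]; ring
      rw [e]
      have : 0 ≤ ((j : ℝ) + 1) * (min h Hs) ^ 2 := by positivity
      nlinarith
    have hrange := range_of_lateral (j := j) hE hlat
    rw [show (x₀ + M) - x₀ = M by ring, abs_of_nonneg hM0, add_zero] at hrange
    have hcM : |c - x₀| ≤ M := abs_sub_le_max_of_mem_Ioo hc
    have htilt : TiltReady η f x₀ s hmax R Hs B j v := ⟨c, lt_of_le_of_lt hcM hrange, hNL⟩
    exact cumReady_of_ready (Ready := WinOrTilt) (Or.inr htilt)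

/-- ★ A window base inside the COLUMN satisfies the corner inequality for every height `h > 0` (so the corner door generalises the column door). -/
theorem corner_of_columnBase {x₀ R Hs α β h : ℝ} {j : ℕ} (hαβ : α < β) (hh : 0 < h) (hα : x₀ - R / 2 ≤ α) (hβ : β ≤ x₀ + R / 2) :
    (max (max |α - x₀| |β - x₀| - R / 2) 0) ^ 2 + ((j : ℝ) + 1) * (min h Hs) ^ 2 ≤ ((j : ℝ) + 1) * Hs ^ 2 := by
  have hαa : |α - x₀| ≤ R / 2 := by
    rw [abs_le]; constructor <;> linarith
  have hβa : |β - x₀| ≤ R / 2 := by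
    rw [abs_le]; constructor <;> linarith
  have hm : max (max |α - x₀| |β - x₀| - R / 2) 0 = 0 := max_eq_right (by linarith [max_le hαa hβa])
  rw [hm]
  have hj : (0 : ℝ) ≤ (j : ℝ) + 1 := by positivity
  have hmin : (min h Hs) ^ 2 ≤ Hs ^ 2 := by
    rcases le_total h Hs with hle | hle
    · rw [min_eq_left hle]; exact pow_le_pow_left₀ hh.le hle 2
    · rw [min_eq_right hle]
  nlinarith [mul_le_mul_of_nonneg_left hmin hj]

/-- ★ THE `AntiEscapeCore`-SHAPED INSTANCE: at a non-Ready′ level, a corner-admissible Jensen window of `f^{(j)}` with a couple inside yields the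
successor level. -/
theorem antiEscape_instance_of_window_corners {η : ℝ} {f : ℂ → ℂ} {x₀ s hmax R Hs : ℝ} {B j : ℕ} {v : ℂ}
    (hE : EngineHyps5 2 η f x₀ s hmax R Hs B) (hv : StTrkDQ η f x₀ s hmax R Hs B j v) (hnR : ¬ ReadyR2 η f x₀ s hmax R Hs B j v)
    {α β h : ℝ} (hW : Window (iteratedDeriv j f) α β h)
    (hJ : ∃ u ∈ Ioo α β ×ℂ Ioo (-h) h, iteratedDeriv j f u = 0 ∧ u.im ≠ 0)
    (hcorner : (max (max |α - x₀| |β - x₀| - R / 2) 0) ^ 2 + ((j : ℝ) + 1) * (min h Hs) ^ 2 ≤ ((j : ℝ) + 1) * Hs ^ 2) :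
    ∃ u : ℂ, StTrkDQ η f x₀ s hmax R Hs B (j + 1) u :=
  (succ_or_readyR2_of_window_corners hE hv hW hJ hcorner).resolve_right hnR

end RhW08.ClusterQM
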